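import Literature.NumberTheory.GelbartRogawski1991.LocalDoubledUnitaryDatum
import Literature.NumberTheory.Automorphic.QuadraticLocalNormCompatibility
import Literature.NumberTheory.Automorphic.AddCharConductorExponent
import Literature.NumberTheory.Automorphic.AdicCompletionResidueCard
import Literature.RepresentationTheory.HeisenbergGroup.LeraySectionParabolicValue
import Mathlib.RingTheory.Norm.Transitivity
import HarnessLib

-- buildfix G11b-3 recipe (LEDGER B13-1/B13-3): elaborate sequentially so the trailing `attribute [implicit_reducible]`
-- block (reducibilityCoreExt is keyed to the async environment branch) is in force at `.olean` export.
set_option Elab.async false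

/-!
# The parabolic normalisation of the local Weil representation of the doubled unitary group:
# `(M_δ (ω_v(p) (M_δ⁻¹ Φ)))(0) = β(p)⁻¹ · ∏_{w ∣ v} |det_Δ p_w|_w^{1/2} · Φ(0)` on `P_Δ(F_v)`
([Kudla1994, Thm 3.1, §3]; [HarrisKudlaSweet1996, §1 (1.11)–(1.16)]: `ω(m(a))φ(x) = χ(det a)|det a|^{1/2} φ(xa)` on the
Siegel parabolic of `U(n, n)`)

Topic `NumberTheory/GelbartRogawski1991`; namespace
`Literature.NumberTheory.GelbartRogawski1991.UnitaryDualPair.LocalSplitting` (sequel of `LocalDoubledUnitaryDatum`).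
KERNEL only: proved theorems; no definition, no named fact, no `sorry`.

**Setting** (as in `LocalDoubledUnitaryDatum`): `E/F` a quadratic extension of number fields, `c`, `δ`, `d = δ²`, a finite
place `v` of `F`, `𝕍 = (Eⁿ, T₀)`, the doubled space `𝔻 = 𝕍 ⊕ (−𝕍)` with Gram matrix `gramD F n T₀`, the local
symplectic space `𝕎_v = F_v^{n+n} × F_v^{n+n}` of `Res_{E⊗F_v/F_v} 𝔻_v`, the embedding `ι = iotaD : H(F_v) → Sp(𝕎_v)`,
the Lagrangian `ℓ_Δ = deltaLagrangian F v n = Res Δ`, `Δ = {(u, u)}`, the Siegel condition `IsSiegelDelta p :⇔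
ι(p) ℓ_Δ = ℓ_Δ` and the `Δ`-blocks `deltaBlock w p = (p_w)₁₁ + (p_w)₁₂`, `detDelta w p = det (deltaBlock w p)` at the
places `w ∣ v`.

* §1 (**linear algebra of `Res`**) `coe_normAbs_det_restrict_iotaD`: for `p ∈ P_Δ(F_v)`,
  `|det_{F_v}(ι(p)|_{ℓ_Δ})|_v = ∏_{w ∣ v} ‖det_Δ p_w‖_w`.  Proof: `ℓ_Δ ≅ Res_{E⊗F_v/F_v}((E ⊗ F_v)ⁿ)` by
  `a ↦ reIm (a, a)` (an `F_v`-linear isomorphism `θ`), under which `ι(p)|_{ℓ_Δ}` is the restriction of scalars of the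
  `E ⊗ F_v`-linear map `a ↦ (P₁₁ + P₁₂) a` (`P` the matrix of `p` over `E ⊗ F_v = ∏_{w ∣ v} E_w`); hence
  `det_{F_v} = N_{E⊗F_v/F_v}(det_{E⊗F_v}(P₁₁ + P₁₂))` (Mathlib `LinearMap.det_restrictScalars`), whose absolute value is
  `∏_{w ∣ v} ‖det((p_w)₁₁ + (p_w)₁₂)‖_w` (tree `norm_algebraNorm_localRing`, `QuadraticLocalNormCompatibility`).
* §2 (**the parabolic normalisation**) `parabolicNorm_apply_zero`: for a local splitting datum `D` at `ℓ_Δ` whose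
  section `r` is Leray-normalised at the character `ψ_v(½·)` (the `L0` datum of the GR-1 skeleton), every
  `δ ∈ Sp(𝕎_v)` carrying `ℓ_Δ` onto `ℓ_Y = 0 ⊕ F_v^{n+n}`, every `p ∈ P_Δ(F_v)` and every `Φ ∈ 𝒮(F_v^{n+n})`:
  `(r(δ) (ω_v(p) (r(δ)⁻¹ Φ)))(0) = β(p)⁻¹ · (∏_{w ∣ v} ‖det_Δ p_w‖_w^{1/2}) · Φ(0)`, where `ω_v(p) = β(p)⁻¹ r(ι p)`
  (`LocalSplittingDatum.localOmega_apply`); by the HeisenbergGroup theorem `apply_zero_conj_eq_gram`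
  (`LeraySectionParabolicValue`: `((r δ · r g · r δ⁻¹) Φ)(0) = |det(g|_ℓ)|^{1/2} Φ(0)`) and §1.  With Kudla's values
  `β|_{P_Δ} = χ_v ∘ det_Δ` of the skeleton this is the display
  `(M_δ (ω_v(p) (M_δ⁻¹ Φ)))(0) = χ_v(det_Δ p)⁻¹ |det_Δ p|^{1/2} Φ(0)` consumed by the adelic assembly (`FinLocalFamily`).

Written for the kernel construction of [GelbartRogawski1991, Prop. 3.1.1] behind the cited input `hGRU` of the
Hodge-CM period-theorem package (stage-1 cell `pub-hodgecm`, seat GR-1, junction L8 of the local skeleton).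
Nothing in this file is a claim of the manuscripts adjudicated by that cell.

## References

* S. S. Kudla, *Splitting metaplectic covers of dual reductive pairs*, Israel J. Math. 87 (1994) 361–401, Thm 3.1, §3
  [Kudla1994].
* M. Harris, S. S. Kudla, W. J. Sweet, *Theta dichotomy for unitary groups*, J. Amer. Math. Soc. 9 (1996) 941–1004,
  §1 (1.11)–(1.16) [HarrisKudlaSweet1996].
* R. Ranga Rao, Pacific J. Math. 157 (1993) 335–371, Lemma 3.2, Thm 3.5 [Rangarao1993].
-/

set_option autoImplicit false

noncomputable section

open NumberField IsDedekindDomain MeasureTheory Matrix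
open scoped NNReal
open Literature.RepresentationTheory.HeisenbergGroup
open Literature.NumberTheory.Automorphic Literature.NumberTheory.Automorphic.UnitaryGroup
open Literature.NumberTheory.Automorphic.UnitaryGroup.QuadraticCoordinates
open Literature.NumberTheory.GaloisRepresentations.IsNonarchimedeanLocalField
open Literature.NumberTheory.Weil1964 Literature.LinearAlgebra.QuadraticForm

namespace Literature.NumberTheory.GelbartRogawski1991.UnitaryDualPair.LocalSplitting

variable (F : Type) [Field F] [NumberField F] (E : Type) [Field E] [NumberField E] [Algebra F E]
  [Algebra.IsQuadraticExtension F E] (c : E ≃ₐ[F] E)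
  {δ : E} (hcδ : c δ = -δ) (hδ : δ ≠ 0) {d : F} (hd : δ * δ = algebraMap F E d)
  (v : HeightOneSpectrum (𝓞 F)) (n : ℕ) {T₀ : Matrix (Fin n) (Fin n) F} (hT₀ : T₀.IsSymm) (hT₀d : IsUnit T₀.det)
  {JD : Matrix (Fin (n + n)) (Fin (n + n)) E} (hJD : JD = (gramD F n T₀).map (algebraMap F E))

local notation "K" => HeightOneSpectrum.adicCompletion F v
local notation "S" => LocalRing E v

/-! ## §0 Two bridges -/

omit [Algebra.IsQuadraticExtension F E] in
/-- Mathlib's norm on `F_v` is the normalised absolute value `normAbs` of the local field `F_v` (= the tree's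
`norm_eq_coe_normAbs` of `GlobalHeckeTheoryGL2OfCenterInvariant`, reproduced to keep the import closure small).
[folklore] -/
private theorem norm_eq_coe_normAbs' (x : K) : ‖x‖ = ((normAbs K x : ℝ≥0) : ℝ) := by
  by_cases hx : x = 0
  · rw [hx, norm_zero, map_zero, NNReal.coe_zero]
  have hv : Valued.v x ≠ 0 := (Valuation.ne_zero_iff _).2 hx
  have hxn : Valued.v x = WithZero.exp (Multiplicative.toAdd (WithZero.unzero hv)) := by
    rw [WithZero.exp, ofAdd_toAdd, WithZero.coe_unzero]
  rw [FinitePlace.norm_def, WithZeroMulInt.toNNReal_neg_apply _ hv,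
    normAbs_eq_inv_zpow_of_valued_eq v hxn, residueFieldCard_adicCompletion_eq, _root_.inv_zpow', neg_neg]
  rfl

/-- `ι(p) (reIm u) = reIm (P u)` for the matrix `P` of `p` over `E ⊗ F_v` (the tree's `localToSymplectic_reIm`
through `iota_def`). [cite: MoeglinVignerasWaldspurger1987, Ch. 1 I.17] -/
theorem toLin_iotaD_reIm (p : UnitaryGroup.localPi E c (n + n) JD v) (u : Fin (n + n) → S) :
    toLin F v (iotaD F E c hcδ hδ hd v n hT₀ hJD p)
        (reIm (quadraticLocalEquiv E v c hcδ hδ).toLinearEquiv.toAddEquiv (Fin (n + n)) u) =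
      reIm (quadraticLocalEquiv E v c hcδ hδ).toLinearEquiv.toAddEquiv (Fin (n + n))
        (((localPiEquiv E c (n + n) JD v p).1 : GL (Fin (n + n)) S).1 *ᵥ u) := by
  rw [iotaD, iota_def, UnitaryGroup.localPiToSymplectic, MonoidHom.comp_apply]
  exact localToSymplectic_reIm E c (n + n) v hcδ hδ hd (gramD_isSymm F n hT₀) hJD (localPiEquiv E c (n + n) JD v p) u

/-! ## §1 `|det_{F_v}(ι(p)|_{ℓ_Δ})|_v = ∏_{w ∣ v} ‖det_Δ p_w‖_w` -/

/-- **`reIm u ∈ ℓ_Δ ↔ u ∈ Δ ⊗ F_v`** (the two halves of `u ∈ (E ⊗ F_v)^{n+n}` agree).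
[cite: HarrisKudlaSweet1996, §1 (1.11)] -/
theorem reIm_mem_deltaLagrangian_iff (u : Fin (n + n) → S) :
    reIm (quadraticLocalEquiv E v c hcδ hδ).toLinearEquiv.toAddEquiv (Fin (n + n)) u ∈ deltaLagrangian F v n ↔
      ∀ i : Fin n, u (e₂ n (Sum.inl i)) = u (e₂ n (Sum.inr i)) := by
  set Ψ := (quadraticLocalEquiv E v c hcδ hδ).toLinearEquiv.toAddEquiv
  constructor
  · intro h i
    obtain ⟨h1, h2⟩ := h i
    simp only [reIm_apply_fst, reIm_apply_snd] at h1 h2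
    rw [← apply_re_im Ψ (u (e₂ n (Sum.inl i))), ← apply_re_im Ψ (u (e₂ n (Sum.inr i))), h1, h2]
  · intro h i
    simp only [reIm_apply_fst, reIm_apply_snd, h i, and_self]

omit [NumberField F] [Algebra.IsQuadraticExtension F E] in
/-- the `𝕍`-half of `P (a, a)` is `(P₁₁ + P₁₂) a` (`e₂`-blocks). [cite: HarrisKudlaSweet1996, §1 (1.11)] -/
private theorem mulVec_dbl_inl (P : Matrix (Fin (n + n)) (Fin (n + n)) S) (a : Fin n → S) (i : Fin n) :
    (P *ᵥ fun k => Sum.elim a a ((e₂ n).symm k)) (e₂ n (Sum.inl i)) =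
      (((Matrix.reindex (e₂ n).symm (e₂ n).symm P).toBlocks₁₁ +
        (Matrix.reindex (e₂ n).symm (e₂ n).symm P).toBlocks₁₂) *ᵥ a) i := by
  simp only [Matrix.mulVec, dotProduct, Matrix.add_apply, Matrix.toBlocks₁₁, Matrix.toBlocks₁₂,
    Matrix.reindex_apply, Matrix.submatrix_apply, Equiv.symm_symm, Matrix.of_apply, add_mul, Finset.sum_add_distrib]
  rw [← (e₂ n).sum_comp, Fintype.sum_sum_type]
  simp only [Equiv.symm_apply_apply, Sum.elim_inl, Sum.elim_inr]

/-- **`det_{F_v}(ι(p)|_{ℓ_Δ}) = N_{E⊗F_v/F_v}(det_{E⊗F_v}(P₁₁ + P₁₂))`** for `p ∈ P_Δ(F_v)`: under the `F_v`-isomorphism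
`θ : (E ⊗ F_v)ⁿ ≅ ℓ_Δ`, `a ↦ reIm (a, a)`, the restriction `ι(p)|_{ℓ_Δ}` is the restriction of scalars of
`a ↦ (P₁₁ + P₁₂) a` (`P (a, a) = ((P₁₁ + P₁₂) a, (P₁₁ + P₁₂) a)` on the Siegel parabolic), and
`det(Res f) = N(det f)` (Mathlib `LinearMap.det_restrictScalars`). [cite: Kudla1994, §3; HarrisKudlaSweet1996, §1 (1.11)] -/
theorem det_restrict_iotaD_eq_norm (p : UnitaryGroup.localPi E c (n + n) JD v)
    (hp : IsSiegelDelta F E c hcδ hδ hd v n hT₀ hJD p) :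
    LinearMap.det ((toLin F v (iotaD F E c hcδ hδ hd v n hT₀ hJD p)).restrict
        (p := deltaLagrangian F v n) (q := deltaLagrangian F v n) fun _ hx => hp.le (Submodule.mem_map_of_mem hx)) =
      Algebra.norm K
        ((Matrix.reindex (e₂ n).symm (e₂ n).symm
              (((localPiEquiv E c (n + n) JD v p).1 : GL (Fin (n + n)) S).1)).toBlocks₁₁ +
          (Matrix.reindex (e₂ n).symm (e₂ n).symm
              (((localPiEquiv E c (n + n) JD v p).1 : GL (Fin (n + n)) S).1)).toBlocks₁₂).det := by
  -- names
  obtain ⟨Ψ, hΨ⟩ : ∃ Ψ : (K × K) ≃+ S, Ψ = (quadraticLocalEquiv E v c hcδ hδ).toLinearEquiv.toAddEquiv := ⟨_, rfl⟩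
  obtain ⟨P, hP⟩ : ∃ P : Matrix (Fin (n + n)) (Fin (n + n)) S,
      P = ((localPiEquiv E c (n + n) JD v p).1 : GL (Fin (n + n)) S).1 := ⟨_, rfl⟩
  obtain ⟨B, hB⟩ : ∃ B : Matrix (Fin n) (Fin n) S,
      B = (Matrix.reindex (e₂ n).symm (e₂ n).symm P).toBlocks₁₁ + (Matrix.reindex (e₂ n).symm (e₂ n).symm P).toBlocks₁₂ :=
    ⟨_, rfl⟩
  have hq : IsQuadraticCoordinates (toLocalRing E v) Ψ (algebraMap E S δ) (d : K) := by
    rw [hΨ]; exact isQuadraticCoordinates_local E v c hcδ hδ hd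
  -- diagonal vectors `(a, a)`
  let dbl : (Fin n → S) → (Fin (n + n) → S) := fun a k => Sum.elim a a ((e₂ n).symm k)
  have dbl_inl : ∀ a i, dbl a (e₂ n (Sum.inl i)) = a i := fun a i => by
    simp only [dbl, Equiv.symm_apply_apply, Sum.elim_inl]
  have dbl_inr : ∀ a i, dbl a (e₂ n (Sum.inr i)) = a i := fun a i => by
    simp only [dbl, Equiv.symm_apply_apply, Sum.elim_inr]
  have dbl_diag : ∀ a i, dbl a (e₂ n (Sum.inl i)) = dbl a (e₂ n (Sum.inr i)) := fun a i => by
    rw [dbl_inl, dbl_inr]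
  have eq_dbl : ∀ u : Fin (n + n) → S, (∀ i, u (e₂ n (Sum.inl i)) = u (e₂ n (Sum.inr i))) →
      u = dbl fun i => u (e₂ n (Sum.inl i)) := fun u hu => by
    funext k
    obtain ⟨s, rfl⟩ := (e₂ n).surjective k
    rcases s with i | i
    · rw [dbl_inl]
    · rw [dbl_inr, hu i]
  have dbl_add : ∀ a b, dbl (a + b) = dbl a + dbl b := fun a b => by
    funext k; simp only [dbl, Pi.add_apply]; cases (e₂ n).symm k <;> rfl
  have dbl_smul : ∀ (t : K) a, dbl (t • a) = t • dbl a := fun t a => by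
    funext k; simp only [dbl, Pi.smul_apply]; cases (e₂ n).symm k <;> rfl
  -- `reIm` is `F_v`-linear
  have reIm_smul : ∀ (t : K) (u : Fin (n + n) → S), reIm Ψ (Fin (n + n)) (t • u) = t • reIm Ψ (Fin (n + n)) u :=
    fun t u => by
    refine Prod.ext (funext fun k => ?_) (funext fun k => ?_)
    · simp only [reIm_apply_fst, Prod.smul_fst, Pi.smul_apply, smul_localRing_def, hq.re_mul, hq.re_map, hq.im_map,
        zero_mul, mul_zero, add_zero, smul_eq_mul]
    · simp only [reIm_apply_snd, Prod.smul_snd, Pi.smul_apply, smul_localRing_def, hq.im_mul, hq.re_map, hq.im_map,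
        zero_mul, add_zero, smul_eq_mul]
  -- membership of `reIm (a, a)` in `ℓ_Δ`
  have hmemΨ : ∀ u : Fin (n + n) → S, reIm Ψ (Fin (n + n)) u ∈ deltaLagrangian F v n ↔
      ∀ i : Fin n, u (e₂ n (Sum.inl i)) = u (e₂ n (Sum.inr i)) := fun u => by
    rw [hΨ]; exact reIm_mem_deltaLagrangian_iff F E c hcδ hδ v n u
  have hmem : ∀ a, reIm Ψ (Fin (n + n)) (dbl a) ∈ deltaLagrangian F v n := fun a => (hmemΨ _).2 (dbl_diag a)
  -- the `F_v`-isomorphism `θ : (E ⊗ F_v)ⁿ ≅ ℓ_Δ`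
  let θ : (Fin n → S) ≃ₗ[K] deltaLagrangian F v n :=
    { toFun := fun a => ⟨reIm Ψ (Fin (n + n)) (dbl a), hmem a⟩
      invFun := fun q => fun i => (reIm Ψ (Fin (n + n))).symm (q : (Fin (n + n) → K) × (Fin (n + n) → K)) (e₂ n (Sum.inl i))
      map_add' := fun a b => Subtype.ext (by
        simp only [Submodule.coe_add]
        rw [dbl_add, map_add])
      map_smul' := fun t a => Subtype.ext (by
        simp only [Submodule.coe_smul, RingHom.id_apply]
        rw [dbl_smul, reIm_smul])
      left_inv := fun a => funext fun i => by
        simp only [AddEquiv.symm_apply_apply]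
        exact dbl_inl a i
      right_inv := fun q => Subtype.ext (by
        have hu := (hmemΨ ((reIm Ψ (Fin (n + n))).symm (q : (Fin (n + n) → K) × (Fin (n + n) → K)))).1
          (by rw [AddEquiv.apply_symm_apply]; exact q.2)
        change reIm Ψ (Fin (n + n)) (dbl fun i => (reIm Ψ (Fin (n + n))).symm
            (q : (Fin (n + n) → K) × (Fin (n + n) → K)) (e₂ n (Sum.inl i))) = (q : (Fin (n + n) → K) × (Fin (n + n) → K))
        rw [← eq_dbl _ hu, AddEquiv.apply_symm_apply]) }
  -- `P (a, a) = ((B a), (B a))` on the Siegel parabolic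
  have hPdbl : ∀ a, P *ᵥ dbl a = dbl (B *ᵥ a) := fun a => by
    have hdiag : ∀ i : Fin n, (P *ᵥ dbl a) (e₂ n (Sum.inl i)) = (P *ᵥ dbl a) (e₂ n (Sum.inr i)) := by
      refine (hmemΨ _).1 ?_
      have h := hp.le (Submodule.mem_map_of_mem (hmem a))
      rw [hΨ, toLin_iotaD_reIm F E c hcδ hδ hd v n hT₀ hJD, ← hP, ← hΨ] at h
      exact h
    rw [eq_dbl _ hdiag]
    congr 1
    funext i
    rw [hB]
    exact mulVec_dbl_inl F E v n P a i
  -- `ι(p)|_{ℓ_Δ} = θ ∘ Res(B) ∘ θ⁻¹`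
  have hconj : (toLin F v (iotaD F E c hcδ hδ hd v n hT₀ hJD p)).restrict
        (p := deltaLagrangian F v n) (q := deltaLagrangian F v n) (fun _ hx => hp.le (Submodule.mem_map_of_mem hx)) =
      (θ : (Fin n → S) →ₗ[K] deltaLagrangian F v n) ∘ₗ ((Matrix.toLin' B).restrictScalars K) ∘ₗ
        (θ.symm : deltaLagrangian F v n →ₗ[K] (Fin n → S)) := by
    apply LinearMap.ext
    intro q
    obtain ⟨a, rfl⟩ := θ.surjective q
    apply Subtype.ext
    have hsymm : θ.symm (θ a) = a := θ.symm_apply_apply a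
    simp only [LinearMap.coe_restrict_apply, LinearMap.comp_apply, LinearEquiv.coe_coe, hsymm,
      LinearMap.restrictScalars_apply, Matrix.toLin'_apply]
    change toLin F v (iotaD F E c hcδ hδ hd v n hT₀ hJD p) (reIm Ψ (Fin (n + n)) (dbl a)) =
      reIm Ψ (Fin (n + n)) (dbl (B *ᵥ a))
    rw [hΨ, toLin_iotaD_reIm F E c hcδ hδ hd v n hT₀ hJD, ← hP, hPdbl]
  rw [hconj, LinearMap.det_conj, LinearMap.det_restrictScalars, LinearMap.det_toLin', hB, hP]

omit [Algebra.IsQuadraticExtension F E] in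
/-- the `w`-component of `det (P₁₁ + P₁₂)` is `det_Δ p_w`. [cite: Kudla1994, §3] -/
theorem det_deltaBlockS_apply (p : UnitaryGroup.localPi E c (n + n) JD v) (w : PlacesOver E v) :
    ((Matrix.reindex (e₂ n).symm (e₂ n).symm
            (((localPiEquiv E c (n + n) JD v p).1 : GL (Fin (n + n)) S).1)).toBlocks₁₁ +
        (Matrix.reindex (e₂ n).symm (e₂ n).symm
            (((localPiEquiv E c (n + n) JD v p).1 : GL (Fin (n + n)) S).1)).toBlocks₁₂).det w =
      detDelta F E c v n w p := by
  have hw : (((localPiEquiv E c (n + n) JD v p).1 : GL (Fin (n + n)) S).1).map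
      (Pi.evalRingHom _ w) =
      (((p : UnitaryGroup.LocalGLPi E (n + n) v) w : GL (Fin (n + n)) (w.1.adicCompletion E)) :
        Matrix (Fin (n + n)) (Fin (n + n)) (w.1.adicCompletion E)) := by
    rw [coe_localPiEquiv_apply]
    exact GLn.map_piEquiv_symm _ _ _ w
  change (Pi.evalRingHom (fun w : PlacesOver E v => w.1.adicCompletion E) w) (Matrix.det _) = _
  rw [RingHom.map_det, RingHom.mapMatrix_apply, Matrix.map_add _ (map_add _)]
  unfold detDelta deltaBlock
  rw [← hw]
  rfl

/-- **`|det_{F_v}(ι(p)|_{ℓ_Δ})|_v = ∏_{w ∣ v} ‖det_Δ p_w‖_w`** for `p ∈ P_Δ(F_v)` (normalised absolute values; §1 and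
`‖N_{E⊗F_v/F_v} y‖_v = ∏_{w ∣ v} ‖y_w‖_w`). [cite: Kudla1994, Thm 3.1, §3; HarrisKudlaSweet1996, §1 (1.15)–(1.16)] -/
theorem coe_normAbs_det_restrict_iotaD (p : UnitaryGroup.localPi E c (n + n) JD v)
    (hp : IsSiegelDelta F E c hcδ hδ hd v n hT₀ hJD p) :
    ((normAbs K (LinearMap.det ((toLin F v (iotaD F E c hcδ hδ hd v n hT₀ hJD p)).restrict
        (p := deltaLagrangian F v n) (q := deltaLagrangian F v n) fun _ hx => hp.le (Submodule.mem_map_of_mem hx))) : ℝ≥0) : ℝ) =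
      ∏ w : PlacesOver E v, ‖detDelta F E c v n w p‖ := by
  rw [← norm_eq_coe_normAbs', det_restrict_iotaD_eq_norm F E c hcδ hδ hd v n hT₀ hJD p hp, norm_algebraNorm_localRing]
  exact Finset.prod_congr rfl fun w _ => by rw [det_deltaBlockS_apply]

/-! ## §2 The parabolic normalisation -/

omit [Algebra.IsQuadraticExtension F E] in
/-- `β_{𝕋_v}(·, y)` is continuous (the proof term inside `localSchrodinger`; any proof will do by proof irrelevance).
[folklore] -/
private theorem continuous_localPairing_left'' (y : Fin (n + n) → K) :
    Continuous fun u : Fin (n + n) → K => localPairing F (n + n) (gramD F n T₀) v u y := by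
  simp only [Matrix.toLinearMap₂'_apply', dotProduct]
  exact continuous_finsetSum _ fun i _ => (continuous_apply i).mul continuous_const

variable [MeasurableSpace (HeightOneSpectrum.adicCompletion F v)] [BorelSpace (HeightOneSpectrum.adicCompletion F v)]
  (μ : Measure (HeightOneSpectrum.adicCompletion F v)) [μ.IsAddHaarMeasure]

/-- **THE PARABOLIC NORMALISATION (junction L8 of the GR-1 local skeleton).**  Let `D` be a local splitting datum of
the doubled unitary group at the Lagrangian `ℓ_Δ` whose section `r` is Leray-normalised at the character `ψ_v(½·)`
(Rao's normalisation; the `L0` datum), `δ ∈ Sp(𝕎_v)` with `δ ℓ_Δ = ℓ_Y = 0 ⊕ F_v^{n+n}`, `p ∈ P_Δ(F_v)` and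
`Φ ∈ 𝒮(F_v^{n+n})`.  Then, with `ω_v(p) = β(p)⁻¹ r(ι p)` the datum's Weil representation,

  `(r(δ) (ω_v(p) (r(δ)⁻¹ Φ)))(0) = β(p)⁻¹ · ∏_{w ∣ v} ‖det_Δ p_w‖_w^{1/2} · Φ(0)`.

[cite: Kudla1994, Thm 3.1, §3; HarrisKudlaSweet1996, §1 (1.15)–(1.16); Rangarao1993, Lemma 3.2 (1), Thm 3.5] -/
theorem parabolicNorm_apply_zero
    (D : LocalSplittingDatum F E c (n + n) hcδ hδ hd (gramD F n T₀) (gramD_isSymm F n hT₀) (isUnit_det_gramD F n hT₀d)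
      hJD v μ (deltaLagrangian F v n) (deltaLagrangian_orthogonal F v n T₀ hT₀d))
    (hr : ∀ g₁ g₂ : LocalSp F (n + n) (gramD F n T₀) v, D.r.cocycle D.hU g₁ g₂ =
      localLeray F (n + n) (gramD F n T₀) (isUnit_det_gramD F n hT₀d) v μ ((adeleAddCharAt F v).mulShift (⅟(2 : K)))
        (isContinuousNontrivial_mulShift_half (isContinuousNontrivial_adeleAddCharAt F v)) (deltaLagrangian F v n)
        (deltaLagrangian_orthogonal F v n T₀ hT₀d) g₁ g₂)
    (δ' : LocalSp F (n + n) (gramD F n T₀) v)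
    (hδ' : (deltaLagrangian F v n).map (toLin F v δ') = lagrangianY F (n + n) v)
    (p : UnitaryGroup.localPi E c (n + n) JD v) (hp : IsSiegelDelta F E c hcδ hδ hd v n hT₀ hJD p)
    (Φ : SchwartzBruhat (Fin (n + n) → K)) :
    (((D.r δ') (D.localOmega p ((D.r δ').symm Φ)) : SchwartzBruhat (Fin (n + n) → K)) : (Fin (n + n) → K) → ℂ) 0 =
      (((D.beta p)⁻¹ : ℂˣ) : ℂ) * ((∏ w : PlacesOver E v, Real.sqrt ‖detDelta F E c v n w p‖ : ℝ) : ℂ) *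
        ((Φ : SchwartzBruhat (Fin (n + n) → K)) : (Fin (n + n) → K) → ℂ) 0 := by
  have hψ := isContinuousNontrivial_adeleAddCharAt F v
  have hTK : IsUnit (localGram F (n + n) (gramD F n T₀) v).det :=
    UnitaryGroup.isUnit_det_map (algebraMap F K) (isUnit_det_gramD F n hT₀d)
  -- the section is Leray-normalised at `ψ_v(½·)` in the HeisenbergGroup spelling
  have hr' : D.r.cocycle D.hU = lerayCentralCocycle μ (isContinuousNontrivial_mulShift_half hψ)
      (isAlt_alt_polar_gram (localGram F (n + n) (gramD F n T₀) v))
      (nondegenerate_alt_polar_gram (localGram F (n + n) (gramD F n T₀) v) hTK)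
      (deltaLagrangian_orthogonal F v n T₀ hT₀d) :=
    Literature.GroupTheory.CentralCocycle.ext fun g₁ g₂ => hr g₁ g₂
  -- D6 at `g = ι(p)`
  have key := apply_zero_conj_eq_gram (localGram F (n + n) (gramD F n T₀) v) hTK
    (isLocallyConstant_of_isContinuousNontrivial hψ) (continuous_localPairing_left'' F v n) μ hψ
    D.hU D.r (deltaLagrangian_orthogonal F v n T₀ hT₀d) hr' δ' hδ' (iotaD F E c hcδ hδ hd v n hT₀ hJD p) hp Φ
  -- `r(δ) (ω(p) (r(δ)⁻¹ Φ)) = β(p)⁻¹ • (r δ · r(ιp) · r δ⁻¹) Φ`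
  have hlhs : (D.r δ') (D.localOmega p ((D.r δ').symm Φ)) =
      (((D.beta p)⁻¹ : ℂˣ) : ℂ) • ((D.r δ' * D.r (iotaD F E c hcδ hδ hd v n hT₀ hJD p) * (D.r δ')⁻¹) Φ) := by
    rw [LocalSplittingDatum.localOmega_apply, Units.smul_def, LinearEquiv.map_smul, LinearEquiv.mul_apply,
      LinearEquiv.mul_apply, LinearEquiv.coe_inv]
  rw [hlhs, Submodule.coe_smul, Pi.smul_apply, smul_eq_mul, key, ← mul_assoc]
  congr 2
  -- `√(∏ x_w) = ∏ √x_w`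
  refine congrArg Complex.ofReal ?_
  rw [Real.sqrt_eq_iff_eq_sq (NNReal.coe_nonneg _) (Finset.prod_nonneg fun _ _ => Real.sqrt_nonneg _),
    ← Finset.prod_pow, coe_normAbs_det_restrict_iotaD F E c hcδ hδ hd v n hT₀ hJD p hp]
  exact Finset.prod_congr rfl fun w _ => (Real.sq_sqrt (norm_nonneg _)).symm

/-! ### Build-lane note (ops-buildfix G11b-3 recipe, LEDGER B13-1, 2026-08-21)
`lean -o` (the hub build lane, never `lean`/the gate check) runs Lean 4.32's library-suggestion indexers
(`Lean.LibrarySuggestions.SymbolFrequency` / `SineQuaNon`, from their `exportEntriesFn`) over the statement of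
every local theorem that is not a denied premise; on this family's statements (very large dependent binder
telescopes through the theta-kernel / dual-pair data) that fold runs for tens of minutes to hours and the build
lane kills the job (incident G11b-3, run/shared/lean/ops/buildfix/G11b-3-DOSSIER.md). `isDeniedPremise` skips
`[implicit_reducible]` constants before any fold, and a reducibility status on a *theorem* is inert (Meta never
unfolds `thmInfo`; the kernel ignores the attribute), so the public theorems of this file are tagged
`[implicit_reducible]` purely to keep them out of that index. Only other effect: they are not offered by
`+suggestions` premise selectors. No statement or proof is changed; superseded if the operator lands a
deny-list form (`HarnessLib.PremiseIndex`). -/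
set_option allowUnsafeReducibility true in
attribute [implicit_reducible]
  toLin_iotaD_reIm reIm_mem_deltaLagrangian_iff det_restrict_iotaD_eq_norm det_deltaBlockS_apply
  coe_normAbs_det_restrict_iotaD parabolicNorm_apply_zero

end Literature.NumberTheory.GelbartRogawski1991.UnitaryDualPair.LocalSplitting

end
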